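import Summits.RiemannHypothesis.RiemannHypothesis.Theorems.Splittings.JensenWindowCensus

/-!
# Jensen-window census III (part 3/4) — the local critical-point count (Kim 1996 Thm 1) and the local dichotomy

Cell rh-split, seat rh-split-jen-neg g7 (scratch `SketchG7.lean` 02ca2ea96404222a; staged monolith 1f49da2f12defbf0, farm
rc 0 / 0 sorries, standard axioms; referee g5 REPLAY PASS ×2 + BYTES PASS), cut per rh-split-lead RULING #63/#63b (OPTION A:
all four parts under Theorems/Splittings/, parts 1–3 def-carrying = definition lane, part 4 = the item proof).  Decl bodies
verbatim (renames vs the monolith: `zeroCount ↦ zeroCountC`, `exists_ball_ne_zero ↦ exists_ball_ne_zero_of_entire`; the helper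
`analyticOrderAt_ne_top_of_entire` became private copies `…_aux`).  Zero `sorry`, no instances, no notation.
HONEST LABEL: «SPLITTING SEARCH over kernel-typed RH-EQUIVALENCES; a splitting A ∧ B ⟹ RH is CONDITIONAL
bookkeeping unless A and B are both proved; nothing here bears on the truth of RH.»

IN PRINT: the census identity, the real-axis Rolle/Pólya equation and the local critical-point count
are Y.-O. Kim, Proc. AMS 124 (1996) 819–830 [Kim1996], Theorem 1 p. 821 and its proof — (2.3) `Im z · Im f'/f < 0` off the
Jensen set, (2.4) `(1/2π) Δ_Γ arg f'/f = ½(sgn f'(a)/f(a) − sgn f'(b)/f(b))`, and Pólya's 1930 equation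
`2K = N' − N − ½(sgn f'(a)/f(a) − sgn f'(b)/f(b))` (Quart. J. Math. Oxford 1, pp. 29–30), pp. 822–823 — stated there for `f` of
genus `1*` on a strip `a ≤ Re z ≤ b` with `a, b` outside the Jensen set.  Here: an ARBITRARY real entire `f`, a bounded window
`[α,β] × [−h,h]`, the pointwise boundary-sign hypothesis `Im w · Im (f'/f)(w) < 0` on the non-real boundary (which (2.3)
supplies in Kim's setting), multiplicities, and the exact rectangle argument principle of
`Literature.Analysis.Complex.ArgumentPrincipleRectangle` — a formalisation and mild generalisation, not a new theorem.
Further sources: Ki–Kim, Duke Math. J. 104 (2000) §3 (3.1) p. 54, Thm 4.1 p. 60 [KiKim2000] (`KiKim.fourK`);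
Craven–Csordas–Smith, Ann. of Math. 125 (1987) (Jensen discs).

Bridges between the complex analytic order of a real entire `f` at a real point and the real-analytic order of `Re f|ℝ`
(`analyticOrderAt_re_ofReal_eq`, `zeroCountC_real_eq`, `sign_mul_cast_eq_sgn`); `rolleIdentity_of_localB(_core)` (Pólya's
equation in `KiKim.fourK` form) and `local_deGua_count(_core)` (Kim 1996 Thm 1 in window form):
`2·[(non-real zeros of f in K°) − (non-real zeros of f' in K°)] = KiKim.fourK (Re f|ℝ) α β`, four times the number of
non-Laguerre («critical») points on `(α,β)` (`KiKim.fourK_nonneg_dvd_iff`); `nonreal_zeros_deriv_le` (`J' ≤ J`); the LOCAL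
DICHOTOMY `no_nonreal_zero_of_localA_localB(_core)`: local A ∧ local B on a sign window ⟹ `f` has no non-real zero in `K°`;
and the tube lemma `sign_persists_near_segment`.
-/

noncomputable section

open Complex Filter Metric Set Topology
open scoped ComplexConjugate

set_option linter.dupNamespace false

namespace Summit.RiemannHypothesis.RiemannHypothesis.Theorems.Splittings.JensenWindow

open Literature.Analysis.Complex

variable {f g : ℂ → ℂ}

/-! ## 3b. L2 = the tree's Fourier–Hurwitz–Ki–Kim count (`KiKim.fourK_nonneg_dvd_iff`)

The real Rolle identity with multiplicities is Hurwitz's formula (Ki–Kim 2000, (3.1)), proved in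
the tree for real-analytic `F : ℝ → ℝ`.  We bridge it to the complex-side counts used by the census:
the complex analytic order of a real entire `f` at a real point equals the real-analytic order of
`Re f|ℝ` there. -/

/-- `sign (u v) = sgn (v / u)` for non-zero reals. -/
theorem sign_mul_cast_eq_sgn {u v : ℝ} (hu : u ≠ 0) (hv : v ≠ 0) :
    (((SignType.sign (u * v) : SignType) : ℤ) : ℂ) = sgn (v / u) := by
  have huv : u * v = v / u * u ^ 2 := by
    rw [div_mul_eq_mul_div, eq_div_iff hu]; ring
  by_cases h : 0 < v / u
  · have h2 : 0 < u * v := by rw [huv]; positivity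
    rw [sign_pos h2, sgn, if_pos h]; simp
  · have h1 : v / u < 0 := lt_of_le_of_ne (not_lt.mp h) (div_ne_zero hv hu)
    have h2 : u * v < 0 := by rw [huv]; exact mul_neg_of_neg_of_pos h1 (by positivity)
    rw [sign_neg h2, sgn, if_neg h]; simp

/-- An entire function which is not identically zero has finite analytic order everywhere (private copy of
`Literature.NumberTheory.LFunctions.analyticOrderAt_ne_top_of_entire`, to keep the import cone small). -/
private theorem analyticOrderAt_ne_top_of_entire_aux {g : ℂ → ℂ} (hg : Differentiable ℂ g) {a : ℂ}
    (ha : g a ≠ 0) (z : ℂ) : analyticOrderAt g z ≠ ⊤ := by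
  intro htop
  rw [analyticOrderAt_eq_top] at htop
  have hAn : AnalyticOnNhd ℂ g univ := fun w _ ↦ hg.analyticAt w
  have h := hAn.eqOn_zero_of_preconnected_of_eventuallyEq_zero isPreconnected_univ (mem_univ z) htop
  exact ha (h (mem_univ a))

/-- **Bridge**: for a real entire `g`, the real-analytic order of `Re g|ℝ` at a real point is the
complex analytic order of `g` there. -/
theorem analyticOrderAt_re_ofReal_eq {g : ℂ → ℂ} (hg : Differentiable ℂ g)
    (hreal : ∀ x : ℝ, (g x).im = 0) {x : ℝ} {n : ℕ} (hn : analyticOrderAt g (x : ℂ) = n) :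
    analyticOrderAt (fun s : ℝ ↦ (g s).re) x = n := by
  obtain ⟨q, hq, hq0, hev⟩ := ((hg.analyticAt (x : ℂ)).analyticOrderAt_eq_natCast).mp hn
  have hFan : AnalyticAt ℝ (fun s : ℝ ↦ (g s).re) x := KiKim.analyticAt_re_ofReal hg x
  have hevR : ∀ᶠ s : ℝ in 𝓝 x, g s = (((s - x) ^ n : ℝ) : ℂ) * q s := by
    have ht : Tendsto (fun s : ℝ ↦ (s : ℂ)) (𝓝 x) (𝓝 (x : ℂ)) :=
      Complex.continuous_ofReal.tendsto x
    filter_upwards [ht.eventually hev] with s hs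
    rw [hs, smul_eq_mul]
    push_cast
    ring
  have hqim : ∀ᶠ s : ℝ in 𝓝[≠] x, (q s).im = 0 := by
    have h1 : ∀ᶠ s : ℝ in 𝓝[≠] x, g s = (((s - x) ^ n : ℝ) : ℂ) * q s :=
      hevR.filter_mono nhdsWithin_le_nhds
    have h2 : ∀ᶠ s : ℝ in 𝓝[≠] x, s ≠ x := self_mem_nhdsWithin
    filter_upwards [h1, h2] with s hs hsx
    have him := congrArg Complex.im hs
    rw [hreal s, Complex.im_ofReal_mul] at him
    exact (mul_eq_zero.mp him.symm).resolve_left (pow_ne_zero _ (sub_ne_zero.mpr hsx))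
  have hqc : ContinuousAt (fun s : ℝ ↦ (q s).im) x := by
    have h1 : ContinuousAt (fun s : ℝ ↦ q s) x :=
      hq.continuousAt.comp (f := fun s : ℝ ↦ (s : ℂ)) Complex.continuous_ofReal.continuousAt
    exact Complex.continuous_im.continuousAt.comp h1
  have hqx : (q x).im = 0 := by
    have t1 : Tendsto (fun s : ℝ ↦ (q s).im) (𝓝[≠] x) (𝓝 ((q x).im)) :=
      hqc.tendsto.mono_left nhdsWithin_le_nhds
    have t2 : Tendsto (fun s : ℝ ↦ (q s).im) (𝓝[≠] x) (𝓝 0) :=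
      tendsto_const_nhds.congr' (hqim.mono fun s hs ↦ hs.symm)
    exact tendsto_nhds_unique t1 t2
  set G : ℝ → ℝ := fun s ↦ (q s).re with hGdef
  have hG : AnalyticAt ℝ G x := by
    have h1 : AnalyticAt ℝ (fun s : ℝ ↦ (s : ℂ)) x := Complex.ofRealCLM.analyticAt x
    have h2 : AnalyticAt ℝ q (x : ℂ) := hq.restrictScalars
    exact (Complex.reCLM.analyticAt _).comp (h2.comp h1)
  have hGx : G x ≠ 0 := by
    intro h0
    apply hq0
    exact Complex.ext (by simpa [G] using h0) (by simpa using hqx)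
  have hevF : ∀ᶠ s : ℝ in 𝓝 x, (fun s : ℝ ↦ (g s).re) s = (s - x) ^ n • G s := by
    filter_upwards [hevR] with s hs
    simp only [smul_eq_mul, G]
    rw [hs, Complex.re_ofReal_mul]
  exact (hFan.analyticOrderAt_eq_natCast).mpr ⟨G, hG, hGx, hevF⟩

/-- The bridge on the level of integer multiplicities. -/
theorem analyticOrderNatAt_re_ofReal_eq {g : ℂ → ℂ} (hg : Differentiable ℂ g)
    (hreal : ∀ x : ℝ, (g x).im = 0) {x : ℝ} (hfin : analyticOrderAt g (x : ℂ) ≠ ⊤) :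
    ((analyticOrderNatAt (fun s : ℝ ↦ (g s).re) x : ℕ) : ℤ) = (meromorphicOrderAt g x).untop₀ := by
  have hn : analyticOrderAt g (x : ℂ) = ((analyticOrderNatAt g (x : ℂ) : ℕ) : ℕ∞) :=
    (Nat.cast_analyticOrderNatAt hfin).symm
  have hR := analyticOrderAt_re_ofReal_eq hg hreal hn
  simp only [analyticOrderNatAt] at hR ⊢
  rw [hR, (hg.analyticAt _).meromorphicOrderAt_eq, hn]
  simp

/-- **Count bridge**: the census's real-axis count equals the tree's `KiKim.zeroCount` of
`Re g|ℝ` on `[α, β]` (endpoints are not zeros). -/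
theorem zeroCount_real_eq {g : ℂ → ℂ} (hg : Differentiable ℂ g) (hreal : ∀ x : ℝ, (g x).im = 0)
    {α β h : ℝ} (hpos : 0 < h) (hα : g α ≠ 0) (hβ : g β ≠ 0) :
    zeroCountC g ((Ioo α β ×ℂ Ioo (-h) h) ∩ {ρ | ρ.im = 0}) =
      (KiKim.zeroCount (fun t : ℝ ↦ (g t).re) α β : ℂ) := by
  classical
  set G : ℝ → ℝ := fun t ↦ (g t).re with hGdef
  have greal : ∀ t : ℝ, g t = ((G t : ℝ) : ℂ) := fun t ↦
    Complex.ext (by simp [G]) (by simp [hreal t])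
  have hG0 : ∀ t : ℝ, G t = 0 ↔ g t = 0 := fun t ↦
    ⟨fun h0 ↦ by rw [greal t, h0]; simp, fun h0 ↦ by simp [G, h0]⟩
  have hGan : ∀ x, AnalyticAt ℝ G x := KiKim.analyticAt_re_ofReal hg
  have hGne : G ≠ 0 := fun h0 ↦ hα ((hG0 α).mp (by rw [h0]; rfl))
  have hfinZ := KiKim.finite_zeros_Icc hGan hGne α β
  have hR : KiKim.zeroCount G α β = ∑ t ∈ hfinZ.toFinset, analyticOrderNatAt G t :=
    KiKim.zeroCount_eq_sum (fun t ht ↦ ((Set.Finite.mem_toFinset _).mp ht).1)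
      (fun t ht h0 ↦ (Set.Finite.mem_toFinset _).mpr ⟨ht, h0⟩)
  have hset : {ρ : ℂ | g ρ = 0 ∧ ρ ∈ (Ioo α β ×ℂ Ioo (-h) h) ∩ {ρ | ρ.im = 0}} =
      (fun t : ℝ ↦ (t : ℂ)) '' {x | x ∈ Icc α β ∧ G x = 0} := by
    ext ρ
    simp only [mem_setOf_eq, mem_inter_iff, mem_image, mem_reProdIm]
    constructor
    · rintro ⟨h0, ⟨hre, -⟩, him0⟩
      have e : ρ = ((ρ.re : ℝ) : ℂ) := Complex.ext (by simp) (by simp [him0])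
      refine ⟨ρ.re, ⟨Ioo_subset_Icc_self hre, ?_⟩, e.symm⟩
      rw [hG0, ← e]; exact h0
    · rintro ⟨t, ⟨ht, h0⟩, rfl⟩
      have hgt : g t = 0 := (hG0 t).mp h0
      have htα : t ≠ α := fun e ↦ hα (e ▸ hgt)
      have htβ : t ≠ β := fun e ↦ hβ (e ▸ hgt)
      refine ⟨hgt, ⟨?_, ?_⟩, by simp⟩
      · simpa using ⟨lt_of_le_of_ne ht.1 (Ne.symm htα), lt_of_le_of_ne ht.2 htβ⟩
      · simpa using hpos
  unfold zeroCountC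
  rw [hset, finsum_mem_image (fun a _ b _ hab ↦ by exact_mod_cast hab),
    finsum_mem_eq_finite_toFinset_sum _ hfinZ, hR, Nat.cast_sum]
  refine Finset.sum_congr rfl fun t _ ↦ ?_
  have hfin : analyticOrderAt g (t : ℂ) ≠ ⊤ := analyticOrderAt_ne_top_of_entire_aux hg hα _
  have L := analyticOrderNatAt_re_ofReal_eq hg hreal hfin
  rw [← L]
  norm_cast

/-- **L2 (Hurwitz 1912 / Ki–Kim (3.1), via the tree).** In a Jensen window, the local Laguerre
sign law B forces the real Rolle identity. (Pólya 1930, Quart. J. Math. Oxford 1, pp. 29–30) [cite: Kim1996, p. 823] -/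
theorem rolleIdentity_of_localB_core (hfd : Differentiable ℂ f) (hreal : ∀ x : ℝ, (f x).im = 0)
    {P : ℂ → Prop} {α β h : ℝ} (hW : SWindow f P α β h)
    (hB : LocalB f α β) : RolleIdentity f α β h := by
  set F : ℝ → ℝ := fun t ↦ (f t).re with hFdef
  have h1d := differentiable_deriv hfd
  have hFan : ∀ x, AnalyticAt ℝ F x := KiKim.analyticAt_re_ofReal hfd
  have hdF : deriv F = fun t : ℝ ↦ (deriv f t).re :=
    funext fun t ↦ (KiKim.hasDerivAt_re_ofReal (hfd.differentiableAt)).deriv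
  have hddF : deriv (deriv F) = fun t : ℝ ↦ (deriv (deriv f) t).re := by
    rw [hdF]; exact funext fun t ↦ (KiKim.hasDerivAt_re_ofReal (h1d.differentiableAt)).deriv
  have dreal : ∀ t : ℝ, (deriv f t).im = 0 := im_deriv_ofReal hfd hreal
  have ddreal : ∀ t : ℝ, (deriv (deriv f) t).im = 0 := im_deriv_ofReal h1d dreal
  have reF : ∀ {t : ℝ}, f t ≠ 0 → F t ≠ 0 := fun {t} ht h0 ↦
    ht (Complex.ext (by simpa [F] using h0) (by simp [hreal t]))
  have reF' : ∀ {t : ℝ}, deriv f t ≠ 0 → (deriv f t).re ≠ 0 := fun {t} ht h0 ↦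
    ht (Complex.ext (by simpa using h0) (by simp [dreal t]))
  have hF'ne : deriv F ≠ 0 := by
    intro h0
    have := congrFun h0 α
    rw [hdF] at this
    exact reF' hW.dα (by simpa using this)
  have hFα' : deriv F α ≠ 0 := by rw [hdF]; exact reF' hW.dα
  have hFβ' : deriv F β ≠ 0 := by rw [hdF]; exact reF' hW.dβ
  obtain ⟨-, -, hiff⟩ :=
    KiKim.fourK_nonneg_dvd_iff hFan hF'ne hW.lt (reF hW.fα) hFα' (reF hW.fβ) hFβ'
  have h4 : KiKim.fourK F α β = 0 := by
    refine hiff.mpr fun c hc hdc hFc ↦ ?_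
    have hdc' : deriv f c = 0 := by
      rw [hdF] at hdc
      exact Complex.ext (by simpa using hdc) (by simp [dreal c])
    have hfc : f c ≠ 0 := fun h0 ↦ hFc (by simp [F, h0])
    have hb := hB c hc hdc' hfc
    have e : (f c * deriv (deriv f) c).re = F c * deriv (deriv F) c := by
      rw [Complex.mul_re, hreal c, hddF]
      simp [F]
    rwa [e] at hb
  -- unpack and bridge
  have h4' : 2 * (KiKim.zeroCount (fun t : ℝ ↦ (deriv f t).re) α β : ℤ) -
      2 * (KiKim.zeroCount F α β : ℤ) -
      ((((SignType.sign (F α * (deriv f α).re) : SignType) : ℤ)) -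
        ((SignType.sign (F β * (deriv f β).re) : SignType) : ℤ)) = 0 := by
    have h := h4
    simp only [KiKim.fourK, KiKim.sFF, hdF] at h
    exact h
  unfold RolleIdentity
  rw [zeroCount_real_eq h1d dreal hW.pos hW.dα hW.dβ,
    zeroCount_real_eq hfd hreal hW.pos hW.fα hW.fβ]
  have quot : ∀ {t : ℝ}, f t ≠ 0 → (deriv f t / f t).re = (deriv f t).re / F t := by
    intro t ht
    have e1 : f t = (((f t).re : ℝ) : ℂ) := Complex.ext (by simp) (by simp [hreal t])
    have e2 : deriv f t = (((deriv f t).re : ℝ) : ℂ) := Complex.ext (by simp) (by simp [dreal t])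
    have e3 : deriv f t / f t = ((((deriv f t).re / (f t).re : ℝ)) : ℂ) := by
      rw [Complex.ofReal_div]; exact congrArg₂ (· / ·) e2 e1
    rw [e3, Complex.ofReal_re]
  have sα : sgn (deriv f α / f α).re =
      (((SignType.sign (F α * (deriv f α).re) : SignType) : ℤ) : ℂ) := by
    rw [sign_mul_cast_eq_sgn (reF hW.fα) (reF' hW.dα), quot hW.fα]
  have sβ : sgn (deriv f β / f β).re =
      (((SignType.sign (F β * (deriv f β).re) : SignType) : ℤ) : ℂ) := by
    rw [sign_mul_cast_eq_sgn (reF hW.fβ) (reF' hW.dβ), quot hW.fβ]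
  rw [sα, sβ]
  have hc := congrArg (Int.cast : ℤ → ℂ) h4'
  push_cast at hc ⊢
  linear_combination hc

/-- L2 in a Jensen window. (Pólya 1930, Quart. J. Math. Oxford 1, pp. 29–30) [cite: Kim1996, p. 823] -/
theorem rolleIdentity_of_localB (hf : RealEntireLt2 f) {α β h : ℝ} (hW : Window f α β h)
    (hB : LocalB f α β) : RolleIdentity f α β h :=
  rolleIdentity_of_localB_core hf.diff hf.real hW.toSWindow hB

/-- **THE LOCAL FOURIER–PÓLYA COUNT (kernel).**  In a Jensen window, the number of NON-REAL
zeros of `f` minus the number of NON-REAL zeros of `f'` (open window, with multiplicity) equals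
`fourK/2 = 2K`, twice the number of Fourier critical zeros of `f'` on `(α, β)` (Hurwitz–Ki–Kim
count of the real trace `F = Re f|ℝ`).  With `KiKim.fourK_nonneg_dvd_iff` (`fourK ≥ 0`, `4 ∣ fourK`)
this is the window-local form of de Gua's rule `J₀ − J₁ = K(f')`. (window form) [cite: Kim1996, Thm 1 p. 821] -/
theorem local_deGua_count_core (hfd : Differentiable ℂ f) (hreal : ∀ x : ℝ, (f x).im = 0)
    {P : ℂ → Prop} (hsgn : ∀ {w : ℂ}, w.im ≠ 0 → P w → w.im * (deriv f w / f w).im < 0)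
    {α β h : ℝ} (hW : SWindow f P α β h) :
    2 * ((zeroCountC f (Ioo α β ×ℂ Ioo (-h) h) - zeroCountC f ((Ioo α β ×ℂ Ioo (-h) h) ∩ {ρ | ρ.im = 0})) -
      (zeroCountC (deriv f) (Ioo α β ×ℂ Ioo (-h) h) -
        zeroCountC (deriv f) ((Ioo α β ×ℂ Ioo (-h) h) ∩ {ρ | ρ.im = 0}))) =
      (KiKim.fourK (fun t : ℝ ↦ (f t).re) α β : ℂ) := by
  set F : ℝ → ℝ := fun t ↦ (f t).re with hFdef
  have h1d := differentiable_deriv hfd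
  have hdF : deriv F = fun t : ℝ ↦ (deriv f t).re :=
    funext fun t ↦ (KiKim.hasDerivAt_re_ofReal (hfd.differentiableAt)).deriv
  have dreal : ∀ t : ℝ, (deriv f t).im = 0 := im_deriv_ofReal hfd hreal
  have reF : ∀ {t : ℝ}, f t ≠ 0 → F t ≠ 0 := fun {t} ht h0 ↦
    ht (Complex.ext (by simpa [F] using h0) (by simp [hreal t]))
  have reF' : ∀ {t : ℝ}, deriv f t ≠ 0 → (deriv f t).re ≠ 0 := fun {t} ht h0 ↦
    ht (Complex.ext (by simpa using h0) (by simp [dreal t]))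
  have hc := census_core hfd hreal hsgn hW
  have h4' : (KiKim.fourK F α β : ℤ) = 2 * (KiKim.zeroCount (fun t : ℝ ↦ (deriv f t).re) α β : ℤ) -
      2 * (KiKim.zeroCount F α β : ℤ) -
      ((((SignType.sign (F α * (deriv f α).re) : SignType) : ℤ)) -
        ((SignType.sign (F β * (deriv f β).re) : SignType) : ℤ)) := by
    simp only [KiKim.fourK, KiKim.sFF, hdF]
  rw [zeroCount_real_eq h1d dreal hW.pos hW.dα hW.dβ,
    zeroCount_real_eq hfd hreal hW.pos hW.fα hW.fβ]
  have quot : ∀ {t : ℝ}, f t ≠ 0 → (deriv f t / f t).re = (deriv f t).re / F t := by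
    intro t ht
    have e1 : f t = (((f t).re : ℝ) : ℂ) := Complex.ext (by simp) (by simp [hreal t])
    have e2 : deriv f t = (((deriv f t).re : ℝ) : ℂ) := Complex.ext (by simp) (by simp [dreal t])
    have e3 : deriv f t / f t = ((((deriv f t).re / (f t).re : ℝ)) : ℂ) := by
      rw [Complex.ofReal_div]; exact congrArg₂ (· / ·) e2 e1
    rw [e3, Complex.ofReal_re]
  have sα : sgn (deriv f α / f α).re =
      (((SignType.sign (F α * (deriv f α).re) : SignType) : ℤ) : ℂ) := by
    rw [sign_mul_cast_eq_sgn (reF hW.fα) (reF' hW.dα), quot hW.fα]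
  have sβ : sgn (deriv f β / f β).re =
      (((SignType.sign (F β * (deriv f β).re) : SignType) : ℤ) : ℂ) := by
    rw [sign_mul_cast_eq_sgn (reF hW.fβ) (reF' hW.dβ), quot hW.fβ]
  rw [sα, sβ] at hc
  have hc4 := congrArg (Int.cast : ℤ → ℂ) h4'
  push_cast at hc hc4 ⊢
  linear_combination (-1 : ℂ) * hc - hc4

/-- The local Fourier–Pólya count in a Jensen window. (window form) [cite: Kim1996, Thm 1 p. 821] -/
theorem local_deGua_count (hf : RealEntireLt2 f) {α β h : ℝ} (hW : Window f α β h)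
    (hex : ∃ a, f a = 0) :
    2 * ((zeroCountC f (Ioo α β ×ℂ Ioo (-h) h) - zeroCountC f ((Ioo α β ×ℂ Ioo (-h) h) ∩ {ρ | ρ.im = 0})) -
      (zeroCountC (deriv f) (Ioo α β ×ℂ Ioo (-h) h) -
        zeroCountC (deriv f) ((Ioo α β ×ℂ Ioo (-h) h) ∩ {ρ | ρ.im = 0}))) =
      (KiKim.fourK (fun t : ℝ ↦ (f t).re) α β : ℂ) := by
  obtain ⟨ρ, C, hρ0, hρ, hgr⟩ := hf.growth
  exact local_deGua_count_core hf.diff hf.real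
    (fun hw hc ↦ im_mul_im_logDeriv_neg hf.diff hρ0 hρ hgr hf.real hex hw hc) hW.toSWindow

/-- Corollary (local Laguerre–Craven–Csordas–Smith inequality): in a Jensen window `f'` has no
more non-real zeros than `f`. (J′ ≤ J) [cite: Kim1996, Thm 1 p. 821] -/
theorem nonreal_zeros_deriv_le (hf : RealEntireLt2 f) {α β h : ℝ} (hW : Window f α β h)
    (hex : ∃ a, f a = 0) :
    ∃ k : ℤ, 0 ≤ k ∧ 4 ∣ k ∧
      2 * ((zeroCountC f (Ioo α β ×ℂ Ioo (-h) h) - zeroCountC f ((Ioo α β ×ℂ Ioo (-h) h) ∩ {ρ | ρ.im = 0})) -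
        (zeroCountC (deriv f) (Ioo α β ×ℂ Ioo (-h) h) -
          zeroCountC (deriv f) ((Ioo α β ×ℂ Ioo (-h) h) ∩ {ρ | ρ.im = 0}))) = (k : ℂ) := by
  set F : ℝ → ℝ := fun t ↦ (f t).re with hFdef
  have hfd := hf.diff
  have hFan : ∀ x, AnalyticAt ℝ F x := KiKim.analyticAt_re_ofReal hfd
  have hdF : deriv F = fun t : ℝ ↦ (deriv f t).re :=
    funext fun t ↦ (KiKim.hasDerivAt_re_ofReal (hfd.differentiableAt)).deriv
  have dreal : ∀ t : ℝ, (deriv f t).im = 0 := im_deriv_ofReal hfd hf.real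
  have reF : ∀ {t : ℝ}, f t ≠ 0 → F t ≠ 0 := fun {t} ht h0 ↦
    ht (Complex.ext (by simpa [F] using h0) (by simp [hf.real t]))
  have reF' : ∀ {t : ℝ}, deriv f t ≠ 0 → (deriv f t).re ≠ 0 := fun {t} ht h0 ↦
    ht (Complex.ext (by simpa using h0) (by simp [dreal t]))
  have hF'ne : deriv F ≠ 0 := by
    intro h0
    have := congrFun h0 α
    rw [hdF] at this
    exact reF' hW.dα (by simpa using this)
  have hFα' : deriv F α ≠ 0 := by rw [hdF]; exact reF' hW.dα
  have hFβ' : deriv F β ≠ 0 := by rw [hdF]; exact reF' hW.dβ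
  obtain ⟨h0, h4, -⟩ :=
    KiKim.fourK_nonneg_dvd_iff hFan hF'ne hW.lt (reF hW.fα) hFα' (reF hW.fβ) hFβ'
  exact ⟨_, h0, h4, local_deGua_count hf hW hex⟩

/-- **THE LOCAL DICHOTOMY (kernel).** For a real entire `f` of order `< 2` and a Jensen window
`[α,β] × [−h,h]`: if the zeros of `f'` in the open window are real (local A) and the Laguerre
sign law holds at the real critical points of `f` in `(α,β)` off the zeros of `f` (local B),
then every zero of `f` in the open window is real. (corollary) [cite: Kim1996, Thm 1 p. 821] -/
theorem no_nonreal_zero_of_localA_localB (hf : RealEntireLt2 f) {α β h : ℝ} (hW : Window f α β h)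
    (hA : LocalA f α β h) (hB : LocalB f α β) :
    ∀ ρ ∈ Ioo α β ×ℂ Ioo (-h) h, f ρ = 0 → ρ.im = 0 :=
  no_nonreal_zero_of_rolle hf hW hA (rolleIdentity_of_localB hf hW hB)

/-- **THE LOCAL DICHOTOMY, core form (no growth hypothesis).** `f` entire and real on `ℝ`; a sign
window whose predicate forces `Im w · Im (f'/f)(w) < 0` at the non-real boundary points; local A
and local B. Then `f` has no non-real zero in the open window. (corollary) [cite: Kim1996, Thm 1 p. 821] -/
theorem no_nonreal_zero_of_localA_localB_core (hfd : Differentiable ℂ f)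
    (hreal : ∀ x : ℝ, (f x).im = 0) {P : ℂ → Prop}
    (hsgn : ∀ {w : ℂ}, w.im ≠ 0 → P w → w.im * (deriv f w / f w).im < 0)
    {α β h : ℝ} (hW : SWindow f P α β h) (hA : LocalA f α β h) (hB : LocalB f α β) :
    ∀ ρ ∈ Ioo α β ×ℂ Ioo (-h) h, f ρ = 0 → ρ.im = 0 :=
  no_nonreal_zero_of_rolle_core hfd hreal hsgn hW hA (rolleIdentity_of_localB_core hfd hreal hW hB)

/-- **Lemma B.** A strict sign of `Im (g'/g)` on a compact vertical segment persists on nearby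
vertical segments. -/
theorem sign_persists_near_segment (hg : Differentiable ℂ g) {a y₀ Y : ℝ}
    (hside : ∀ y ∈ Icc y₀ Y, (deriv g ((a : ℂ) + (y : ℂ) * I) / g ((a : ℂ) + (y : ℂ) * I)).im < 0) :
    ∃ δ > 0, ∀ x y : ℝ, |x - a| < δ → y ∈ Icc y₀ Y →
      (deriv g ((x : ℂ) + (y : ℂ) * I) / g ((x : ℂ) + (y : ℂ) * I)).im < 0 := by
  set ψ : ℂ → ℂ := fun z ↦ deriv g z / g z with hψ
  set U : Set ℂ := {z | g z ≠ 0} ∩ ψ ⁻¹' {w | w.im < 0} with hU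
  have hUo : IsOpen U := by
    apply ContinuousOn.isOpen_inter_preimage
    · intro z hz
      exact (((differentiable_deriv hg).continuous.continuousAt).div
        (hg.continuous.continuousAt) hz).continuousWithinAt
    · exact isOpen_ne_fun hg.continuous continuous_const
    · exact isOpen_lt Complex.continuous_im continuous_const
  set K : Set ℂ := (fun y : ℝ ↦ (a : ℂ) + (y : ℂ) * I) '' Icc y₀ Y with hK
  have hKc : IsCompact K := isCompact_Icc.image (by fun_prop)
  have hKU : K ⊆ U := by
    rintro _ ⟨y, hy, rfl⟩
    have h1 := hside y hy
    refine ⟨fun h0 ↦ ?_, h1⟩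
    rw [h0, div_zero, Complex.zero_im] at h1
    exact lt_irrefl _ h1
  obtain ⟨δ, hδ, hthick⟩ := hKc.exists_thickening_subset_open hUo hKU
  refine ⟨δ, hδ, fun x y hx hy ↦ ?_⟩
  have hmem : ((x : ℂ) + (y : ℂ) * I) ∈ Metric.thickening δ K := by
    rw [Metric.mem_thickening_iff]
    refine ⟨(a : ℂ) + (y : ℂ) * I, ⟨y, hy, rfl⟩, ?_⟩
    rw [dist_eq_norm]
    have e : (x : ℂ) + (y : ℂ) * I - ((a : ℂ) + (y : ℂ) * I) = ((x - a : ℝ) : ℂ) := by push_cast; ring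
    rw [e, Complex.norm_real, Real.norm_eq_abs]
    exact hx
  exact (hthick hmem).2



end Summit.RiemannHypothesis.RiemannHypothesis.Theorems.Splittings.JensenWindow
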